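import Literature.Combinatorics.SimpleGraph.ParkingFunctionsAcyclicOrientations
import Mathlib.InformationTheory.Hamming
import HarnessLib

/-!
# The canonical `Q_n`-parking function: `f(v) = wgt(v) − 1` is a maximum parking function on the
# `n`-cube (Benson–Chakrabarty–Tetali 2010, Theorem 5.2 with Proposition 5.1)

Source (held, read at the page; statements VERBATIM). B. Benson, D. Chakrabarty, P. Tetali,
*`G`-parking functions, acyclic orientations and spanning trees*, Discrete Math. 310 (2010)
1340–1353 [BensonChakrabartyTetali2010] (held text `paper:arxiv-0801.1114`, chunk p0015), §5.2
«`Q_n`-Parking Functions»: «we also view the `n`-cube `Q_n` as the graph on `2^n` vertices, which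
may conveniently be labeled by the `2^n` binary vectors of length `n`, and with edges between
vertices whose Hamming distance is one. We are interested in understanding the parking functions
on `Q_n` with respect to the vertex `q = (0,0,…,0)`. **Definition 5.2.** For `n = 1`, the unique
parking function `f = f^1` on `Q_1` is canonical. For `n > 1`, the parking function
`f^n = f □ f □ ⋯ □ f` (`n` times), obtained using the product graph construction, is defined as the
canonical `Q_n`-parking function. […] Note that by Proposition 5.1, the canonical `Q_n`-parking
function is a maximum parking function […] **Theorem 5.2.** Let `f^n` denote the canonical
`Q_n`-parking function. Then `f^n(v) = wgt(v) − 1`, where `wgt(v)` is the Hamming weight (the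
number of `1`'s in the binary representation) of the vertex `v ∈ V(Q_n)`.»

## What is formalised (vocabulary: `IsReduced G q D` of `ReducedDivisors` — parking functions
## carry `f(q) = −1`, maximum ones have `deg f = g − 1` (`ParkingFunctionsAcyclicOrientations`);
## B–N's `ν_P = orderDivisor G ρ` of `LinearOrderDivisors`)

* `hypercube n` — the `n`-cube on `Fin n → Bool` («edges between vertices whose Hamming distance
  is one», Mathlib's `hammingDist`), `weight v` — the Hamming weight; `hypercube_adj_iff` (the
  neighbours are the single-bit flips), `degree_hypercube` (`= n`),
  `two_mul_card_edgeFinset_hypercube` (`2|E| = n·2^n`), `sum_weight_eq_card_edgeFinset`;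
* **Theorem 5.2 (with Proposition 5.1)** in closed form: `orderDivisor_hypercube_weight` (for the
  ranking by weight, `ν(v) = wgt(v) − 1`: the earlier neighbours of `v` are its `wgt(v)` down-flips),
  **`isReduced_hypercube_weight_sub_one`** (`v ↦ wgt(v) − 1` is a `Q_n`-parking function relative
  to `q = 0`, value `−1` at `q`) and **`sum_weight_sub_one_eq_genus_sub_one`** (its degree is
  `g(Q_n) − 1`, i.e. it is a MAXIMUM parking function).

Decidability of adjacency is taken as a hypothesis (`[DecidableRel (hypercube n).Adj]`), no
instance is declared. Two definitions (`hypercube`, `weight`), theorems otherwise; no `sorry`;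
no named facts.
-/

open Finset SimpleGraph

namespace Literature.Combinatorics.SimpleGraph.BakerNorine

/-! ### §1 The `n`-cube and the Hamming weight -/

section Cube

variable {n : ℕ}

/-- **The `n`-cube `Q_n`**: «the graph on `2^n` vertices […] labeled by the `2^n` binary vectors of
length `n`, and with edges between vertices whose Hamming distance is one».
[cite: BensonChakrabartyTetali2010, §5.2] -/
def hypercube (n : ℕ) : SimpleGraph (Fin n → Bool) where
  Adj v w := hammingDist v w = 1
  symm := ⟨fun v w h => by rw [hammingDist_comm]; exact h⟩
  loopless := ⟨fun v h => by rw [hammingDist_self] at h; exact Nat.zero_ne_one h⟩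

/-- **The Hamming weight** «`wgt(v)` […] (the number of `1`'s in the binary representation) of the
vertex `v ∈ V(Q_n)`». [cite: BensonChakrabartyTetali2010, Theorem 5.2] -/
def weight (v : Fin n → Bool) : ℕ := #{i | v i = true}

/-- Unfolding the adjacency of `Q_n`. [cite: BensonChakrabartyTetali2010, §5.2] -/
theorem hypercube_adj (v w : Fin n → Bool) : (hypercube n).Adj v w ↔ hammingDist v w = 1 :=
  Iff.rfl

/-- Unfolding `wgt`. [cite: BensonChakrabartyTetali2010, Theorem 5.2] -/
theorem weight_apply (v : Fin n → Bool) : weight v = #{i | v i = true} := rfl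

/-- Flipping one coordinate moves to Hamming distance `1`. [folklore] -/
private theorem hammingDist_update_not (v : Fin n → Bool) (i : Fin n) :
    hammingDist v (Function.update v i (!v i)) = 1 := by
  unfold hammingDist
  rw [card_eq_one]
  refine ⟨i, ?_⟩
  ext j
  simp only [mem_filter, mem_univ, true_and, mem_singleton]
  by_cases hji : j = i
  · subst hji; simp
  · simp [hji]

/-- Vectors at Hamming distance `1` are single-bit flips. [folklore] -/
private theorem eq_update_of_hammingDist_eq_one {v w : Fin n → Bool} (h : hammingDist v w = 1) :
    ∃ i : Fin n, w = Function.update v i (!v i) := by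
  unfold hammingDist at h
  obtain ⟨i, hi⟩ := card_eq_one.1 h
  have hmem : ∀ j, v j ≠ w j ↔ j = i := fun j => by
    have := Finset.ext_iff.1 hi j
    simpa using this
  refine ⟨i, funext fun j => ?_⟩
  by_cases hji : j = i
  · subst hji
    rw [Function.update_self]
    have h1 : v j ≠ w j := (hmem j).2 rfl
    revert h1
    cases v j <;> cases w j <;> simp
  · rw [Function.update_of_ne hji]
    by_contra hne
    exact hji ((hmem j).1 (Ne.symm hne))

/-- The neighbours in `Q_n` are exactly the single-bit flips.
[cite: BensonChakrabartyTetali2010, §5.2] -/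
theorem hypercube_adj_iff (v w : Fin n → Bool) :
    (hypercube n).Adj v w ↔ ∃ i : Fin n, w = Function.update v i (!v i) := by
  rw [hypercube_adj]
  refine ⟨eq_update_of_hammingDist_eq_one, ?_⟩
  rintro ⟨i, rfl⟩
  exact hammingDist_update_not v i

/-- Single-bit flips at distinct coordinates are distinct. [folklore] -/
private theorem update_not_injective (v : Fin n → Bool) :
    Function.Injective fun i : Fin n => Function.update v i (!v i) := by
  intro i j h
  by_contra hij
  have h1 := congrFun h i
  simp only [Function.update_self, Function.update_of_ne hij] at h1
  revert h1
  cases v i <;> simp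

variable [DecidableRel (hypercube n).Adj]

/-- The neighbour set of `v` in `Q_n` is the set of its `n` single-bit flips.
[cite: BensonChakrabartyTetali2010, §5.2] -/
theorem neighborFinset_hypercube (v : Fin n → Bool) :
    (hypercube n).neighborFinset v = univ.image fun i : Fin n => Function.update v i (!v i) := by
  ext w
  rw [mem_neighborFinset, hypercube_adj_iff, mem_image]
  constructor
  · rintro ⟨i, rfl⟩; exact ⟨i, mem_univ i, rfl⟩
  · rintro ⟨i, -, rfl⟩; exact ⟨i, rfl⟩

/-- `Q_n` is `n`-regular. [cite: BensonChakrabartyTetali2010, §5.2] -/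
theorem degree_hypercube (v : Fin n → Bool) : (hypercube n).degree v = n := by
  rw [← card_neighborFinset_eq_degree, neighborFinset_hypercube,
    card_image_of_injective _ (update_not_injective v), card_univ, Fintype.card_fin]

/-- `2 |E(Q_n)| = n · 2^n`. [cite: BensonChakrabartyTetali2010, Definition 5.1 (edge count of a
product) and §5.2] -/
theorem two_mul_card_edgeFinset_hypercube : 2 * #(hypercube n).edgeFinset = n * 2 ^ n := by
  rw [← sum_degrees_eq_twice_card_edges, Finset.sum_congr rfl fun v _ => degree_hypercube v,
    sum_const, card_univ, Fintype.card_fun, Fintype.card_bool, Fintype.card_fin, smul_eq_mul,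
    mul_comm]

omit [DecidableRel (hypercube n).Adj] in
/-- Half of the binary vectors have a `1` in a given coordinate. [folklore] -/
private theorem two_mul_card_filter_apply_eq (i : Fin n) :
    2 * #{v : Fin n → Bool | v i = true} = 2 ^ n := by
  have hsplit := Finset.card_filter_add_card_filter_not (s := (univ : Finset (Fin n → Bool)))
    (fun v => v i = true)
  rw [card_univ, Fintype.card_fun, Fintype.card_bool, Fintype.card_fin] at hsplit
  have hflip : #{v : Fin n → Bool | v i = true} = #{v : Fin n → Bool | ¬ v i = true} := by
    refine card_nbij' (fun v => Function.update v i false) (fun v => Function.update v i true)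
      (fun v _ => ?_) (fun v _ => ?_) (fun v hv => ?_) (fun v hv => ?_)
    · simp
    · simp
    · have hv' : v i = true := by simpa using hv
      show Function.update (Function.update v i false) i true = v
      rw [Function.update_idem, ← hv', Function.update_eq_self]
    · have hv' : v i = false := by simpa using hv
      show Function.update (Function.update v i true) i false = v
      rw [Function.update_idem, ← hv', Function.update_eq_self]
  omega

/-- `Σ_v wgt(v) = |E(Q_n)|` (both equal `n · 2^{n−1}`). [cite: BensonChakrabartyTetali2010, §5.2] -/
theorem sum_weight_eq_card_edgeFinset :
    ∑ v : Fin n → Bool, weight v = #(hypercube n).edgeFinset := by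
  have h2 : 2 * ∑ v : Fin n → Bool, weight v = n * 2 ^ n := by
    have hw : ∀ v : Fin n → Bool, weight v = ∑ i, if v i = true then 1 else 0 := fun v => by
      rw [weight_apply, Finset.card_filter]
    simp_rw [hw]
    rw [Finset.sum_comm, Finset.mul_sum]
    have hi : ∀ i : Fin n, 2 * ∑ v : Fin n → Bool, (if v i = true then 1 else 0) = 2 ^ n :=
      fun i => by rw [← Finset.card_filter]; exact two_mul_card_filter_apply_eq i
    simp_rw [hi]
    rw [sum_const, card_univ, Fintype.card_fin, smul_eq_mul]
  have h := two_mul_card_edgeFinset_hypercube (n := n)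
  omega

end Cube

/-! ### §2 Theorem 5.2: `wgt(v) − 1` is the maximum parking function `ν` of the weight order -/

section Canonical

variable {n : ℕ}

/-- Flipping a `1` to `0` lowers the weight by one. [folklore] -/
private theorem weight_update_add_one {v : Fin n → Bool} {i : Fin n} (hi : v i = true) :
    weight (Function.update v i (!v i)) + 1 = weight v := by
  rw [weight_apply, weight_apply]
  have hset : (univ.filter fun j => Function.update v i (!v i) j = true) =
      (univ.filter fun j => v j = true).erase i := by
    ext j
    simp only [mem_filter, mem_univ, true_and, mem_erase]
    by_cases hji : j = i
    · subst hji; simp [hi]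
    · simp [hji]
  rw [hset, card_erase_of_mem (mem_filter.2 ⟨mem_univ i, hi⟩)]
  have : 0 < #(univ.filter fun j => v j = true) := card_pos.2 ⟨i, mem_filter.2 ⟨mem_univ i, hi⟩⟩
  omega

/-- Flipping a `0` to `1` raises the weight by one. [folklore] -/
private theorem weight_update_of_eq_false {v : Fin n → Bool} {i : Fin n} (hi : v i = false) :
    weight (Function.update v i (!v i)) = weight v + 1 := by
  rw [weight_apply, weight_apply]
  have hset : (univ.filter fun j => Function.update v i (!v i) j = true) =
      insert i (univ.filter fun j => v j = true) := by
    ext j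
    simp only [mem_filter, mem_univ, true_and, mem_insert]
    by_cases hji : j = i
    · subst hji; simp [hi]
    · simp [hji]
  rw [hset, card_insert_of_notMem (fun h => by simp [hi] at h)]

/-- `wgt(0) = 0`. [folklore] -/
private theorem weight_zero : weight (fun _ : Fin n => false) = 0 := by
  rw [weight_apply]; simp

variable [DecidableRel (hypercube n).Adj]

/-- For the ranking of `Q_n` by Hamming weight, the earlier neighbours of `v` are its `wgt(v)`
down-flips, so B–N's `ν(v) = wgt(v) − 1`. [cite: BensonChakrabartyTetali2010, Theorem 5.2] -/
theorem orderDivisor_hypercube_weight (v : Fin n → Bool) :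
    orderDivisor (hypercube n) weight v = (weight v : ℤ) - 1 := by
  rw [orderDivisor_apply]
  have hset : {w ∈ (hypercube n).neighborFinset v | weight w < weight v} =
      (univ.filter fun i => v i = true).image fun i => Function.update v i (!v i) := by
    ext w
    simp only [mem_filter, mem_image, mem_univ, true_and, mem_neighborFinset, hypercube_adj_iff]
    constructor
    · rintro ⟨⟨i, rfl⟩, hlt⟩
      refine ⟨i, ?_, rfl⟩
      cases hi : v i
      · have := weight_update_of_eq_false hi; omega
      · rfl
    · rintro ⟨i, hi, rfl⟩
      exact ⟨⟨i, rfl⟩, by have := weight_update_add_one hi; omega⟩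
  rw [hset, card_image_of_injective _ (update_not_injective v), weight_apply]


/-- **Theorem 5.2 (with Proposition 5.1): the canonical `Q_n`-parking function is
`v ↦ wgt(v) − 1`** — here: `v ↦ wgt(v) − 1` is a `Q_n`-parking function relative to
`q = (0,…,0)` (it is B–N's `ν_P` for the order by weight). [cite: BensonChakrabartyTetali2010,
Theorem 5.2] -/
theorem isReduced_hypercube_weight_sub_one :
    IsReduced (hypercube n) (fun _ => false) (fun v => (weight v : ℤ) - 1) := by
  have h := isReduced_orderDivisor_of_forall_exists (G := hypercube n) (fun _ : Fin n => false)
    weight fun v hv => ?_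
  · have heq : orderDivisor (hypercube n) weight = fun v => (weight v : ℤ) - 1 :=
      funext fun v => orderDivisor_hypercube_weight v
    rwa [heq] at h
  · -- a nonzero vertex has a `1`, and flipping it gives an earlier neighbour
    obtain ⟨i, hi⟩ : ∃ i, v i = true := by
      by_contra hall
      push Not at hall
      exact hv (funext fun i => by simpa using hall i)
    refine ⟨Function.update v i (!v i), (hypercube_adj_iff v _).2 ⟨i, rfl⟩, ?_⟩
    have := weight_update_add_one hi
    omega

omit [DecidableRel (hypercube n).Adj] in
/-- Its value at the base vertex is `−1`. [cite: BensonChakrabartyTetali2010, Theorem 5.2] -/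
theorem weight_sub_one_apply_zero : (fun v : Fin n → Bool => (weight v : ℤ) - 1) (fun _ => false) = -1 := by
  simp only [weight_zero, Nat.cast_zero, zero_sub]

/-- **It is a maximum parking function** («by Proposition 5.1, the canonical `Q_n`-parking
function is a maximum parking function»): its degree is `g(Q_n) − 1`.
[cite: BensonChakrabartyTetali2010, Theorem 5.2 (with Proposition 5.1)] -/
theorem sum_weight_sub_one_eq_genus_sub_one :
    ∑ v : Fin n → Bool, ((weight v : ℤ) - 1) = genus (hypercube n) - 1 := by
  rw [Finset.sum_sub_distrib, sum_const, card_univ, genus_eq, ← Nat.cast_sum,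
    sum_weight_eq_card_edgeFinset, Fintype.card_fun, Fintype.card_bool, Fintype.card_fin]
  simp only [Nat.cast_pow, Nat.cast_ofNat]
  ring

/-- The three properties together: `v ↦ wgt(v) − 1` is a maximum `Q_n`-parking function relative
to `q = 0` (`q`-reduced, value `−1` at `q`, degree `g − 1`).
[cite: BensonChakrabartyTetali2010, Theorem 5.2 (with Proposition 5.1)] -/
theorem maximum_hypercube_weight_sub_one :
    IsReduced (hypercube n) (fun _ => false) (fun v => (weight v : ℤ) - 1) ∧
      (fun v : Fin n → Bool => (weight v : ℤ) - 1) (fun _ => false) = -1 ∧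
      ∑ v : Fin n → Bool, ((weight v : ℤ) - 1) = genus (hypercube n) - 1 :=
  ⟨isReduced_hypercube_weight_sub_one, weight_sub_one_apply_zero, sum_weight_sub_one_eq_genus_sub_one⟩

end Canonical

end Literature.Combinatorics.SimpleGraph.BakerNorine
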